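import Summits.QuantumFields.YangMills.Theorems.UnitScaleTiltHalvingHSupURhoWindowsPrelim
import HarnessLib

/-!
# `hP1room` PROGRAMME (LEAD-H BOARD v7 «H = SLetτAllL ∧ SB9γAllL», EDITION γ), row (HARVEST-v2γ) — THE γ-SHIFTED THEOREM-4 ∕ PROPOSITION-3 WINDOWS FROM THE
# SAME CUBIC SMALLNESS `hw`: [3] Prop. 4's linearisation windows ONE LEVEL LOWER (`α₀ ↦ L²α₀`, `t ↦ L·t`, `C₂ ↦ C₂·L²`) as consumed by lit
# ✓`B8Thm4KLevelGamma.thm4_exists_all_levels_supp_landau138_γ` (`hα3`, `hα4`, `h16γ`, `hsmall`, `hc₃`, `hC₂`, `h61`) — SAME `Cw`, no new power of `L`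

Route `UnitScaleTilt`, crux K1 child «MinimiserStabilityRegPr» (stmt-QuantumFields-19200), registered stub `stub_halvingStep` (`BirthV10`).  Cell `ym3-torus`
(HUMAN RULING D-0037: YM₃ on T³ is ladder rung R3 — NOT d = 4, NOT a mass gap, NOT the Clay problem); twin-width seat `ym-ust-19936-w8` g5, row named by LEAD-H
★w5-19200 g6 (H-NAMER WORD 17, 2026-08-28T23:20Z: «(HARVEST-v2γ) γ's shifted [3]-Prop-4 windows … from `hw` (same `Cw` or one more power of `L` — say)»).
`--supports stmt-QuantumFields-19200 --as helper`; THEOREMS ONLY (0 `def`, 0 `sorry`); PURE REAL ARITHMETIC, count-neutral; nothing here claims `hSupU`, `hP1room`,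
the stub, the crux or the gap.

ANSWER: **SAME `Cw`.**  With the schedule letters of ✓`HalvingHSupURhoWindowsRho3.exists_topCall_constants_of_rhoWindow₃` ∕ ✓`HalvingHSiteH42WindowLetters.windowLetters_of_hw`
(`α₀ = ε₀`, `s = (ρ′+M′+1)ε₀`, `α₁ = 198s + 27s∕(LB₀)`, `c⋆ = 5dLB₀(ε₀+α₁)`, `B₀' = 300·L·m₀·(B₀'H + 15L²BG·BR + 3BG·BR·B₂')`, `α₄ = 8B₀'·5dLB₀·(ε₀+α₁)`,
`t = 2(L·c⋆) + 8α₄`) and the cubic smallness `hw : 10²⁹·L¹²·X₀²·Y⁵·Z·((ρ′+M′+1)³ε₀) ≤ 1` (`X₀ = 1+B₀+B₀⁻¹`, `Y = (1+B₀'H)(1+B₂')(1+BG)(1+BR)`, any `Z ≥ 1`), the seven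
γ-shifted windows hold with `C₂γ := 16·(131072·(d+1)²)·L²` (= `33 554 432·L²` at `d = 3`): the unit `V₄ = L⁴X₀Y·n·s` carries `t ≤ 4·10⁹V₄` (✓`Rho3Prelim.letters₃`'s count,
re-derived inline), and `hw` bounds `L¹⁰X₀²Y²n²s ≤ 10⁻²⁹`, which is what the tightest row (`h61γ`: `2C₂γ·t² ≈ 10²⁷·L¹⁰X₀²Y²n²s·s`) consumes; the others need `L²s ≤ 10⁻⁸`,
`L⁴s ≤ 10⁻²²`, `L·t ≤ 4·10⁻¹³`, `L²·t ≤ 4·10⁻¹³`.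

WHAT IS PROVED (ns `…Theorems.HalvingHSupURhoWindowsGamma`): §1 `budgetsγ` (the monomials dropped from `hw`), `exp_window_three_γ`; §2 ★★ `gammaWindows_of_hw` — the seven rows in the
EXACT binder shapes of lit's γ driver (`hα3 hα4 h16γ hsmall hc₃ hC₂ h61`) at `α₀ := ε₀`, `C₂ := C₂γ`, generic `d` with `d = 3`, plus `h61` in the `c⋆` currency (row (3) of the ρ3 harvest);
§3 ★ `gammaWindows_cstar_of_hw` — the three `t`-rows in the `c⋆` currency (`16(L·c⋆) ≤ 1`, `exp(…)(1+…(L·c⋆)) ≤ 2`, `2(L·c⋆) ≤ c3`) for the (γ-2)∕(γ-2c) datum consumers.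

References: T. Bałaban, CMP **99** (1985) 75–102 [Balaban1985RegularSpaces] (Thm 4 p.88, Prop. 3 (1.56)–(1.61) pp.86–87, (1.31) p.82); CMP **98** (1985) 17–51 [Balaban1985Averaging]
(Prop. 4 (134)–(135) p.38).
-/

set_option autoImplicit false

noncomputable section

namespace Summit.QuantumFields.YangMills.Theorems.HalvingHSupURhoWindowsGamma

open Literature.MathematicalPhysics.QuantumFieldTheory.Balaban1983to89
open B7Prop2Explicit (C0 c2')
open B7Prop3Flat (c3)
open HalvingHSupURhoWindowsPrelim (C0_three c2'_three c3_three exp_window_three Y_letters sizes)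

/-! ## §1 The monomials dropped from the cubic smallness -/

/-- **Budgets for the γ windows.**  From `10²⁹ℓ¹²X₀²Y⁵Z·(n²s) ≤ 1` (`ℓ, X₀, Y, Z, n ≥ 1`, `s ≥ 0`): `10⁸ℓ²s ≤ 1`, `10²²ℓ⁴s ≤ 1`, `10²²ℓ⁵X₀Yns ≤ 1`, `10²²ℓ⁶X₀Yns ≤ 1`,
`10²⁹ℓ¹⁰X₀²Y²n²s ≤ 1`, `s ≤ 1`. [cite: Balaban1985RegularSpaces, Thm 4 p.88] (elementary arithmetic; our proof) -/
theorem budgetsγ {ℓ X₀ Y Z n s : ℝ} (hℓ1 : 1 ≤ ℓ) (hX₀1 : 1 ≤ X₀) (hY1 : 1 ≤ Y) (hZ1 : 1 ≤ Z) (hn1 : 1 ≤ n) (hs0 : 0 ≤ s)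
    (hW : (10 : ℝ) ^ 29 * ℓ ^ 12 * X₀ ^ 2 * Y ^ 5 * Z * (n ^ 2 * s) ≤ 1) :
    10 ^ 8 * ℓ ^ 2 * s ≤ 1 ∧ 10 ^ 22 * ℓ ^ 4 * s ≤ 1 ∧ 10 ^ 22 * (ℓ ^ 5 * X₀ * Y * n * s) ≤ 1 ∧ 10 ^ 22 * (ℓ ^ 6 * X₀ * Y * n * s) ≤ 1 ∧
      10 ^ 29 * (ℓ ^ 10 * X₀ ^ 2 * Y ^ 2 * n ^ 2 * s) ≤ 1 ∧ s ≤ 1 := by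
  have hℓ0 : 0 ≤ ℓ := by linarith only [hℓ1]
  have hX₀0 : 0 ≤ X₀ := by linarith only [hX₀1]
  have hY0 : 0 ≤ Y := by linarith only [hY1]
  have hn0 : 0 ≤ n := by linarith only [hn1]
  -- the master monomial dominates each budget monomial
  have hM : ℓ ^ 10 * X₀ ^ 2 * Y ^ 2 * n ^ 2 * s ≤ ℓ ^ 12 * X₀ ^ 2 * Y ^ 5 * Z * (n ^ 2 * s) := by
    have h : ℓ ^ 10 * X₀ ^ 2 * Y ^ 2 * 1 * (n ^ 2 * s) ≤ ℓ ^ 12 * X₀ ^ 2 * Y ^ 5 * Z * (n ^ 2 * s) := by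
      gcongr <;> first | exact hℓ1 | exact hY1 | exact hZ1 | norm_num
    linarith only [h]
  have h5 : 10 ^ 29 * (ℓ ^ 10 * X₀ ^ 2 * Y ^ 2 * n ^ 2 * s) ≤ 1 := by nlinarith only [hM, hW]
  have hA : ℓ ^ 6 * X₀ * Y * n * s ≤ ℓ ^ 10 * X₀ ^ 2 * Y ^ 2 * n ^ 2 * s := by
    have h : ℓ ^ 6 * X₀ ^ 1 * Y ^ 1 * n ^ 1 * s ≤ ℓ ^ 10 * X₀ ^ 2 * Y ^ 2 * n ^ 2 * s := by
      gcongr <;> first | exact hℓ1 | exact hX₀1 | exact hY1 | exact hn1 | norm_num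
    simpa only [pow_one] using h
  have hB : ℓ ^ 5 * X₀ * Y * n * s ≤ ℓ ^ 6 * X₀ * Y * n * s := by
    have h : ℓ ^ 5 * X₀ * Y * n * s ≤ ℓ ^ 6 * X₀ * Y * n * s := by
      (gcongr; first | exact hℓ1 | norm_num)
    exact h
  have hC : ℓ ^ 4 * s ≤ ℓ ^ 5 * X₀ * Y * n * s := by
    have h : ℓ ^ 4 * 1 * 1 * 1 * s ≤ ℓ ^ 5 * X₀ * Y * n * s := by
      gcongr
      all_goals first | exact hℓ1 | exact hX₀1 | exact hY1 | exact hn1 | norm_num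
    linarith only [h]
  have hD : ℓ ^ 2 * s ≤ ℓ ^ 4 * s := by
    have h : ℓ ^ 2 * s ≤ ℓ ^ 4 * s := by
      (gcongr; first | exact hℓ1 | norm_num)
    exact h
  have hE : s ≤ ℓ ^ 2 * s := by
    have h : 1 * s ≤ ℓ ^ 2 * s := mul_le_mul_of_nonneg_right (one_le_pow₀ hℓ1) hs0
    linarith only [h]
  refine ⟨?_, ?_, ?_, ?_, h5, ?_⟩
  · nlinarith only [h5, hA, hB, hC, hD, hs0]
  · nlinarith only [h5, hA, hB, hC, hs0]
  · nlinarith only [h5, hA, hB]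
  · nlinarith only [h5, hA]
  · nlinarith only [h5, hA, hB, hC, hD, hE, hs0]

/-- `exp(4·(800·4²·7)·x) ≤ 9/8` once `10⁸x ≤ 1` — ✓`exp_window_three` (used at `x := L²ε₀`). [cite: Balaban1985RegularSpaces, Prop. 3 p.87] (elementary analysis) -/
theorem exp_window_three_γ {x : ℝ} (hx : 0 ≤ x) (hx8 : 10 ^ 8 * x ≤ 1) :
    Real.exp (4 * (800 * ((3 : ℝ) + 1) ^ 2 * ((3 : ℝ) + 4)) * x) ≤ 9 / 8 :=
  exp_window_three hx hx8

/-! ## §2 The γ-shifted windows from `hw` -/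

set_option maxHeartbeats 400000 in
/-- ★★ **THE γ-SHIFTED THEOREM-4 ∕ PROPOSITION-3 WINDOWS FROM THE CUBIC SMALLNESS — SAME `Cw`.**  In the schedule letters (`α₀ := ε₀`, `s = (ρ′+M′+1)ε₀`,
`α₁`, `c⋆`, `B₀'`, `α₄` by their defining equations; `t = 2(L·c⋆) + 8α₄`; any `Z ≥ 1` in the `(1 + cB9⁻¹)` slot) and under `hw`, with `C₂γ := 16·(131072·(d+1)²)·L²`:
`C0 d·(L²ε₀) ≤ 1∕3`, `4(L²ε₀) ≤ c2' d L`, `16·(L·t) ≤ 1`, `exp(…·(L²ε₀))·(1 + 8·131072(d+1)²·(L·t)) ≤ 2`, `2(L·t) ≤ c3 d L`,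
`8·131072(d+1)²·exp(…·(L²ε₀))·L² ≤ C₂γ`, `2t² + 20dε₀t + 2C₂γt² ≤ ε₀ + α₁`, and the same (1.61) row in the `c⋆` currency — i.e. EXACTLY the binders
`hα3 hα4 h16γ hsmall hc₃ hC₂ h61` of lit ✓`B8Thm4KLevelGamma.thm4_exists_all_levels_supp_landau138_γ` at `d = 3`.
[cite: Balaban1985RegularSpaces, Thm 4 p.88, Prop. 3 (1.56)–(1.61) pp.86–87, (1.31) p.82; Balaban1985Averaging, Prop. 4 (134)–(135) p.38] (elementary arithmetic; our proof) -/
theorem gammaWindows_of_hw (d L : ℕ) (hd : d = 3) (hL : 2 ≤ L) (M' ρ' : ℕ) {m₀ : ℕ}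
    {ε₀ B₀ B₀'H B₂' BG BR α₁ cstar B₀' α₄ Z : ℝ}
    (hε₀ : 0 < ε₀) (hB₀ : 0 < B₀) (hB₀'H : 0 < B₀'H) (hB₂' : 0 ≤ B₂') (hBG : 0 ≤ BG) (hBR : 0 ≤ BR) (hZ1 : 1 ≤ Z)
    (hm₀ : m₀ = 3 * (M' + ρ') + 1)
    (hα₁ : α₁ = 198 * (((ρ' : ℝ) + M' + 1) * ε₀) + 27 * (((ρ' : ℝ) + M' + 1) * ε₀) / ((L : ℝ) * B₀))
    (hcs : cstar = 5 * (d : ℝ) * L * B₀ * (ε₀ + α₁))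
    (hB₀'def : B₀' = 300 * (L : ℝ) * m₀ * (B₀'H + 15 * (L : ℝ) ^ 2 * BG * BR + 3 * BG * BR * B₂'))
    (hα₄ : α₄ = 8 * B₀' * (5 * (d : ℝ) * L * B₀) * (ε₀ + α₁))
    (hw : (10 : ℝ) ^ 29 * (L : ℝ) ^ 12 * (1 + B₀ + B₀⁻¹) ^ 2 * ((1 + B₀'H) * (1 + B₂') * (1 + BG) * (1 + BR)) ^ 5 * Z *
      (((ρ' : ℝ) + M' + 1) ^ 3 * ε₀) ≤ 1) :
    C0 d * ((L : ℝ) ^ 2 * ε₀) ≤ 1 / 3 ∧ 4 * ((L : ℝ) ^ 2 * ε₀) ≤ c2' d L ∧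
    16 * ((L : ℝ) * (2 * (L * cstar) + 8 * α₄)) ≤ 1 ∧
    Real.exp (4 * (800 * ((d : ℝ) + 1) ^ 2 * ((d : ℝ) + 4)) * ((L : ℝ) ^ 2 * ε₀))
      * (1 + 8 * (131072 * ((d : ℝ) + 1) ^ 2) * ((L : ℝ) * (2 * (L * cstar) + 8 * α₄))) ≤ 2 ∧
    2 * ((L : ℝ) * (2 * (L * cstar) + 8 * α₄)) ≤ c3 d L ∧
    8 * (131072 * ((d : ℝ) + 1) ^ 2) * Real.exp (4 * (800 * ((d : ℝ) + 1) ^ 2 * ((d : ℝ) + 4)) * ((L : ℝ) ^ 2 * ε₀)) * (L : ℝ) ^ 2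
      ≤ 16 * (131072 * ((d : ℝ) + 1) ^ 2) * (L : ℝ) ^ 2 ∧
    2 * (2 * (L * cstar) + 8 * α₄) ^ 2 + 20 * d * ε₀ * (2 * (L * cstar) + 8 * α₄)
      + 2 * (16 * (131072 * ((d : ℝ) + 1) ^ 2) * (L : ℝ) ^ 2) * (2 * (L * cstar) + 8 * α₄) ^ 2 ≤ ε₀ + α₁ ∧
    2 * cstar ^ 2 + 20 * d * ε₀ * cstar + 2 * (16 * (131072 * ((d : ℝ) + 1) ^ 2) * (L : ℝ) ^ 2) * cstar ^ 2 ≤ ε₀ + α₁ := by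
  subst hd
  have h3 : ((3 : ℕ) : ℝ) = 3 := by norm_num
  simp only [h3]
  -- letters
  set ℓ : ℝ := (L : ℝ) with hℓdef
  have hℓ2 : (2 : ℝ) ≤ ℓ := by rw [hℓdef]; exact_mod_cast hL
  have hℓ1 : (1 : ℝ) ≤ ℓ := by linarith only [hℓ2]
  have hℓ0 : (0 : ℝ) ≤ ℓ := by linarith only [hℓ2]
  have hρ0 : (0 : ℝ) ≤ ρ' := Nat.cast_nonneg _
  have hM0 : (0 : ℝ) ≤ M' := Nat.cast_nonneg _
  obtain ⟨n, hn⟩ : ∃ n : ℝ, n = (ρ' : ℝ) + M' + 1 := ⟨_, rfl⟩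
  have hn1 : 1 ≤ n := by rw [hn]; linarith only [hρ0, hM0]
  have hn0 : 0 ≤ n := by linarith only [hn1]
  obtain ⟨s, hs⟩ : ∃ s : ℝ, s = n * ε₀ := ⟨_, rfl⟩
  have hs0 : 0 < s := by rw [hs]; positivity
  have hεs : ε₀ ≤ s := by rw [hs]; have := mul_nonneg (sub_nonneg.mpr hn1) hε₀.le; linarith only [this]
  obtain ⟨X₀, hX₀⟩ : ∃ X₀ : ℝ, X₀ = 1 + B₀ + B₀⁻¹ := ⟨_, rfl⟩
  obtain ⟨Y, hY⟩ : ∃ Y : ℝ, Y = (1 + B₀'H) * (1 + B₂') * (1 + BG) * (1 + BR) := ⟨_, rfl⟩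
  have hBinv0 : 0 < B₀⁻¹ := inv_pos.mpr hB₀
  have hX₀1 : 1 ≤ X₀ := by rw [hX₀]; linarith only [hB₀.le, hBinv0.le]
  have hX₀0 : 0 ≤ X₀ := by linarith only [hX₀1]
  have hB₀X : B₀ ≤ X₀ := by rw [hX₀]; linarith only [hBinv0.le]
  have hBiX : B₀⁻¹ ≤ X₀ := by rw [hX₀]; linarith only [hB₀.le]
  obtain ⟨hY1, hB₀'HY, hB₂'Y, hBGY, hBRY, hBGBRY, hBGBRBY, hYlow⟩ := Y_letters hB₀'H.le hB₂' hBG hBR hY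
  have hY0 : 0 ≤ Y := by linarith only [hY1]
  have hW : (10 : ℝ) ^ 29 * ℓ ^ 12 * X₀ ^ 2 * Y ^ 5 * Z * (n ^ 2 * s) ≤ 1 := by
    have h : n ^ 2 * s = ((ρ' : ℝ) + M' + 1) ^ 3 * ε₀ := by rw [hs, hn]; ring
    rw [hX₀, hY, h]; exact hw
  obtain ⟨b1, b2, b3, b4, b5, bs1⟩ := budgetsγ hℓ1 hX₀1 hY1 hZ1 hn1 hs0.le hW
  -- the flat `B₀'♭` and the sizes of `α₁`, `c⋆` (✓`Prelim.sizes` at the flat letters; `m₀`-free rows only)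
  obtain ⟨B₀'b, hB₀'b⟩ : ∃ x : ℝ, x = B₀'H + 15 * ℓ ^ 2 * BG * BR + 3 * BG * BR * B₂' := ⟨_, rfl⟩
  have hα₁' : α₁ = 198 * s + 27 * s / (ℓ * B₀) := by rw [hα₁, hs, hn]
  have hcs' : cstar = 15 * ℓ * B₀ * (ε₀ + α₁) := by rw [hcs]; ring
  obtain ⟨hα₁L, -, hcsL, hcsU, hcs0, -, -, -, hbU, hb0, -⟩ :=
    sizes (α₄ := 8 * B₀'b * cstar) (cB := ℓ * cstar) (cDA := 3 * ℓ ^ 2 * cstar) (Cl := 2 * 579944448 * (120 * (ℓ * cstar) + 2 * (8 * B₀'b * cstar)))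
      hℓ1 hB₀ hX₀1 hB₀X hBiX hY1 hB₀'H hB₂' hBG hBR hYlow hs0 hε₀ hεs hα₁' hcs' hB₀'b rfl rfl rfl rfl
  -- `m₀ ≤ 3n`, `B₀' = 300ℓm₀B₀'♭`, `α₄ = 2400ℓm₀B₀'♭c⋆ ≤ 4·10⁸·V₄`
  have hm3 : (m₀ : ℝ) ≤ 3 * n := by
    have e : (m₀ : ℝ) = 3 * ((M' : ℝ) + ρ') + 1 := by rw [hm₀]; push_cast; ring
    rw [e, hn]; linarith only [hρ0, hM0]
  have hm0 : (0 : ℝ) ≤ m₀ := Nat.cast_nonneg _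
  have hB₀'E : B₀' = 300 * ℓ * m₀ * B₀'b := by rw [hB₀'def, hB₀'b]
  have hα₄E : α₄ = 2400 * ℓ * m₀ * B₀'b * cstar := by rw [hα₄, hB₀'E, hcs']; ring
  set V₄ : ℝ := ℓ ^ 4 * X₀ * Y * n * s with hV₄
  have hV₄0 : 0 ≤ V₄ := by positivity
  have hα₄0 : 0 ≤ α₄ := by rw [hα₄E]; positivity
  have hα₄U : α₄ ≤ 4 * 10 ^ 8 * V₄ := by
    rw [hα₄E]
    have e1 : ℓ * m₀ * B₀'b * cstar ≤ ℓ * (3 * n) * (15 * ℓ ^ 2 * Y) * (3390 * ℓ * X₀ * s) :=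
      mul_le_mul (mul_le_mul (mul_le_mul_of_nonneg_left hm3 hℓ0) hbU hb0.le (by positivity)) hcsU hcs0.le (by positivity)
    have e2 : ℓ * (3 * n) * (15 * ℓ ^ 2 * Y) * (3390 * ℓ * X₀ * s) = 152550 * V₄ := by rw [hV₄]; ring
    linarith only [e1, e2, hV₄0]
  have hunit2 : ℓ ^ 2 * X₀ * s ≤ V₄ := by
    have h : ℓ ^ 2 * X₀ * 1 * 1 * s ≤ ℓ ^ 4 * X₀ * Y * n * s := by gcongr; norm_num
    rw [hV₄]; linarith only [h]
  -- `t = 2(ℓc⋆) + 8α₄ ≤ 4·10⁹·V₄`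
  set t : ℝ := 2 * (ℓ * cstar) + 8 * α₄ with ht
  have ht0 : 0 ≤ t := by positivity
  have hℓcs : ℓ * cstar ≤ 3390 * V₄ := by
    calc ℓ * cstar ≤ ℓ * (3390 * ℓ * X₀ * s) := mul_le_mul_of_nonneg_left hcsU hℓ0
      _ = 3390 * (ℓ ^ 2 * X₀ * s) := by ring
      _ ≤ 3390 * V₄ := by linarith only [hunit2]
  have htU : t ≤ 4 * 10 ^ 9 * V₄ := by
    rw [ht]; linarith only [hℓcs, hα₄U, hV₄0]
  -- the `V₄`-monomials against the budgets
  have hℓV : ℓ * V₄ = ℓ ^ 5 * X₀ * Y * n * s := by rw [hV₄]; ring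
  have hℓ2V : ℓ ^ 2 * V₄ = ℓ ^ 6 * X₀ * Y * n * s := by rw [hV₄]; ring
  have hℓt : 10 ^ 12 * (ℓ * t) ≤ 1 := by
    have e : ℓ * t ≤ 4 * 10 ^ 9 * (ℓ * V₄) := by nlinarith only [htU, hℓ0]
    rw [hℓV] at e; linarith only [e, b3]
  have hℓ2t : 10 ^ 12 * (ℓ ^ 2 * t) ≤ 1 := by
    have e : ℓ ^ 2 * t ≤ 4 * 10 ^ 9 * (ℓ ^ 2 * V₄) := by nlinarith only [htU, pow_nonneg hℓ0 2]
    rw [hℓ2V] at e; linarith only [e, b4]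
  have hℓt0 : 0 ≤ ℓ * t := by positivity
  -- `ℓ²ε₀`
  have hℓ2ε : 10 ^ 8 * (ℓ ^ 2 * ε₀) ≤ 1 := by nlinarith only [b1, hεs, pow_nonneg hℓ0 2]
  have hℓ4ε : 10 ^ 22 * (ℓ ^ 4 * ε₀) ≤ 1 := by nlinarith only [b2, hεs, pow_nonneg hℓ0 4]
  have hℓ2ε0 : 0 ≤ ℓ ^ 2 * ε₀ := by positivity
  have hexp := exp_window_three_γ hℓ2ε0 hℓ2ε
  have hexp0 : 0 ≤ Real.exp (4 * (800 * ((3 : ℝ) + 1) ^ 2 * ((3 : ℝ) + 4)) * (ℓ ^ 2 * ε₀)) := Real.exp_nonneg _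
  have hK : 8 * (131072 * ((3 : ℝ) + 1) ^ 2) = 16777216 := by norm_num
  have hK2 : 16 * (131072 * ((3 : ℝ) + 1) ^ 2) = 33554432 := by norm_num
  refine ⟨?_, ?_, ?_, ?_, ?_, ?_, ?_, ?_⟩
  · -- `C0 3 · (ℓ²ε₀) ≤ 1/3`
    rw [C0_three]; linarith only [hℓ2ε]
  · -- `4(ℓ²ε₀) ≤ c2' 3 L = 1/(14336 ℓ²)`
    rw [c2'_three, ← hℓdef]
    have hℓ2pos : (0 : ℝ) < 14336 * ℓ ^ 2 := by positivity
    rw [le_div_iff₀ hℓ2pos]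
    have e : 4 * (ℓ ^ 2 * ε₀) * (14336 * ℓ ^ 2) = 57344 * (ℓ ^ 4 * ε₀) := by ring
    rw [e]; linarith only [hℓ4ε]
  · -- `16(ℓt) ≤ 1`
    linarith only [hℓt, hℓt0]
  · -- `hsmall` at `(ℓ²ε₀, ℓ·t)`
    rw [hK]
    have h1 : 1 + 16777216 * (ℓ * t) ≤ 3 / 2 := by linarith only [hℓt, hℓt0]
    have h2 : 0 ≤ 1 + 16777216 * (ℓ * t) := by positivity
    exact (mul_le_mul hexp h1 h2 (by norm_num)).trans (by norm_num)
  · -- `2(ℓt) ≤ c3 3 L = 1/(512 ℓ)`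
    rw [c3_three, ← hℓdef]
    have hℓpos : (0 : ℝ) < 512 * ℓ := by positivity
    rw [le_div_iff₀ hℓpos]
    have e : 2 * (ℓ * t) * (512 * ℓ) = 1024 * (ℓ ^ 2 * t) := by ring
    rw [e]; linarith only [hℓ2t]
  · -- `hC₂` with `C₂γ = 33554432·ℓ²`
    rw [hK, hK2]
    have hℓ20 : (0 : ℝ) ≤ ℓ ^ 2 := pow_nonneg hℓ0 2
    calc 16777216 * Real.exp (4 * (800 * ((3 : ℝ) + 1) ^ 2 * ((3 : ℝ) + 4)) * (ℓ ^ 2 * ε₀)) * ℓ ^ 2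
        = (16777216 * ℓ ^ 2) * Real.exp (4 * (800 * ((3 : ℝ) + 1) ^ 2 * ((3 : ℝ) + 4)) * (ℓ ^ 2 * ε₀)) := by ring
      _ ≤ (16777216 * ℓ ^ 2) * (9 / 8) := mul_le_mul_of_nonneg_left hexp (by positivity)
      _ ≤ 33554432 * ℓ ^ 2 := by nlinarith only [hℓ20]
  · -- `h61` in the `t` currency
    rw [hK2]
    have htt : t * t ≤ (4 * 10 ^ 9) ^ 2 * (V₄ * V₄) := by nlinarith only [htU, ht0, hV₄0]
    have hVV : ℓ ^ 2 * (V₄ * V₄) = (ℓ ^ 10 * X₀ ^ 2 * Y ^ 2 * n ^ 2 * s) * s := by rw [hV₄]; ring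
    have hℓVV : 10 ^ 29 * (ℓ ^ 2 * (V₄ * V₄)) ≤ s := by rw [hVV]; nlinarith only [b5, hs0.le]
    have hVVs : 10 ^ 29 * (V₄ * V₄) ≤ s := by
      have e : V₄ * V₄ ≤ ℓ ^ 2 * (V₄ * V₄) := by
        have := mul_le_mul_of_nonneg_right (one_le_pow₀ hℓ1 : (1 : ℝ) ≤ ℓ ^ 2) (mul_nonneg hV₄0 hV₄0)
        linarith only [this]
      linarith only [e, hℓVV]
    have hεt : ε₀ * t ≤ 4 * 10 ^ 9 * (s * V₄) := by nlinarith only [htU, hεs, hε₀.le, ht0, hV₄0]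
    have hsV : 10 ^ 13 * (s * V₄) ≤ s := by
      -- `V₄ ≤ ℓ⁵X₀Yns ≤ 10⁻²²`
      have e : V₄ ≤ ℓ ^ 5 * X₀ * Y * n * s := by
        have h : ℓ ^ 4 * X₀ * Y * n * s ≤ ℓ ^ 5 * X₀ * Y * n * s := by
          (gcongr; first | exact hℓ1 | norm_num)
        rw [hV₄]; exact h
      nlinarith only [e, b3, hs0.le, hV₄0]
    nlinarith only [htt, hℓVV, hVVs, hεt, hsV, hα₁L, hεs, hε₀.le, hs0.le, pow_nonneg hℓ0 2, ht0, hV₄0]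
  · -- `h61` in the `c⋆` currency
    rw [hK2]
    have hcV : cstar ≤ 3390 * V₄ := by
      have e : ℓ * X₀ * s ≤ V₄ := by
        have h : ℓ ^ 1 * X₀ * 1 * 1 * s ≤ ℓ ^ 4 * X₀ * Y * n * s := by gcongr; norm_num
        rw [hV₄]; simpa only [pow_one, mul_one] using h
      linarith only [hcsU, e]
    have hcc : cstar * cstar ≤ 3390 ^ 2 * (V₄ * V₄) := by nlinarith only [hcV, hcs0.le, hV₄0]
    have hVV : ℓ ^ 2 * (V₄ * V₄) = (ℓ ^ 10 * X₀ ^ 2 * Y ^ 2 * n ^ 2 * s) * s := by rw [hV₄]; ring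
    have hℓVV : 10 ^ 29 * (ℓ ^ 2 * (V₄ * V₄)) ≤ s := by rw [hVV]; nlinarith only [b5, hs0.le]
    have hVVs : 10 ^ 29 * (V₄ * V₄) ≤ s := by
      have e : V₄ * V₄ ≤ ℓ ^ 2 * (V₄ * V₄) := by
        have := mul_le_mul_of_nonneg_right (one_le_pow₀ hℓ1 : (1 : ℝ) ≤ ℓ ^ 2) (mul_nonneg hV₄0 hV₄0)
        linarith only [this]
      linarith only [e, hℓVV]
    have hεc : ε₀ * cstar ≤ 3390 * (s * V₄) := by nlinarith only [hcV, hεs, hε₀.le, hcs0.le, hV₄0]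
    have hsV : 10 ^ 13 * (s * V₄) ≤ s := by
      have e : V₄ ≤ ℓ ^ 5 * X₀ * Y * n * s := by
        have h : ℓ ^ 4 * X₀ * Y * n * s ≤ ℓ ^ 5 * X₀ * Y * n * s := by
          (gcongr; first | exact hℓ1 | norm_num)
        rw [hV₄]; exact h
      nlinarith only [e, b3, hs0.le, hV₄0]
    nlinarith only [hcc, hℓVV, hVVs, hεc, hsV, hα₁L, hεs, hε₀.le, hs0.le, pow_nonneg hℓ0 2, hcs0.le, hV₄0]

/-- ★ **THE SAME THREE `t`-ROWS IN THE `c⋆` CURRENCY** (the datum-size slot of the (γ-2)∕(γ-2c) consumers ✓`topRows_of_datum_traceFree_γ` ∕ `siteTop_of_datum_γ`, which read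
[3] Prop. 4's windows at `(L²ε₀, L·c⋆)`): `16·(L·c⋆) ≤ 1`, `exp(…(L²ε₀))·(1 + 8·131072(d+1)²·(L·c⋆)) ≤ 2`, `2(L·c⋆) ≤ c3 d L` — from ★★`gammaWindows_of_hw` by
`c⋆ ≤ t = 2(L·c⋆) + 8α₄`. [cite: Balaban1985RegularSpaces, Prop. 3 p.87, (1.69) p.88; Balaban1985Averaging, Prop. 4 (134)–(135) p.38] (elementary arithmetic; our proof) -/
theorem gammaWindows_cstar_of_hw (d L : ℕ) (hd : d = 3) (hL : 2 ≤ L) (M' ρ' : ℕ) {m₀ : ℕ}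
    {ε₀ B₀ B₀'H B₂' BG BR α₁ cstar B₀' α₄ Z : ℝ}
    (hε₀ : 0 < ε₀) (hB₀ : 0 < B₀) (hB₀'H : 0 < B₀'H) (hB₂' : 0 ≤ B₂') (hBG : 0 ≤ BG) (hBR : 0 ≤ BR) (hZ1 : 1 ≤ Z)
    (hm₀ : m₀ = 3 * (M' + ρ') + 1)
    (hα₁ : α₁ = 198 * (((ρ' : ℝ) + M' + 1) * ε₀) + 27 * (((ρ' : ℝ) + M' + 1) * ε₀) / ((L : ℝ) * B₀))
    (hcs : cstar = 5 * (d : ℝ) * L * B₀ * (ε₀ + α₁))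
    (hB₀'def : B₀' = 300 * (L : ℝ) * m₀ * (B₀'H + 15 * (L : ℝ) ^ 2 * BG * BR + 3 * BG * BR * B₂'))
    (hα₄ : α₄ = 8 * B₀' * (5 * (d : ℝ) * L * B₀) * (ε₀ + α₁))
    (hw : (10 : ℝ) ^ 29 * (L : ℝ) ^ 12 * (1 + B₀ + B₀⁻¹) ^ 2 * ((1 + B₀'H) * (1 + B₂') * (1 + BG) * (1 + BR)) ^ 5 * Z *
      (((ρ' : ℝ) + M' + 1) ^ 3 * ε₀) ≤ 1) :
    16 * ((L : ℝ) * cstar) ≤ 1 ∧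
    Real.exp (4 * (800 * ((d : ℝ) + 1) ^ 2 * ((d : ℝ) + 4)) * ((L : ℝ) ^ 2 * ε₀))
      * (1 + 8 * (131072 * ((d : ℝ) + 1) ^ 2) * ((L : ℝ) * cstar)) ≤ 2 ∧
    2 * ((L : ℝ) * cstar) ≤ c3 d L := by
  obtain ⟨-, -, h16, hsmall, hc3, -⟩ := gammaWindows_of_hw d L hd hL M' ρ' hε₀ hB₀ hB₀'H hB₂' hBG hBR hZ1 hm₀ hα₁ hcs hB₀'def hα₄ hw
  have hL0 : (0 : ℝ) ≤ L := Nat.cast_nonneg _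
  have hL1 : (1 : ℝ) ≤ L := by exact_mod_cast le_trans (by norm_num) hL
  have hρ0 : (0 : ℝ) ≤ ρ' := Nat.cast_nonneg _
  have hM0 : (0 : ℝ) ≤ M' := Nat.cast_nonneg _
  have hm0 : (0 : ℝ) ≤ m₀ := Nat.cast_nonneg _
  have hs0 : 0 ≤ ((ρ' : ℝ) + M' + 1) * ε₀ := by positivity
  have hα₁0 : 0 ≤ α₁ := by rw [hα₁]; positivity
  have hcs0 : 0 ≤ cstar := by rw [hcs]; positivity
  have hB₀'0 : 0 ≤ B₀' := by rw [hB₀'def]; positivity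
  have hα₄0 : 0 ≤ α₄ := by rw [hα₄]; positivity
  -- `c⋆ ≤ t = 2(L·c⋆) + 8α₄`
  have hct : (L : ℝ) * cstar ≤ (L : ℝ) * (2 * (L * cstar) + 8 * α₄) := by
    apply mul_le_mul_of_nonneg_left _ hL0
    nlinarith only [hL1, hcs0, hα₄0]
  have hexp0 : 0 ≤ Real.exp (4 * (800 * ((d : ℝ) + 1) ^ 2 * ((d : ℝ) + 4)) * ((L : ℝ) ^ 2 * ε₀)) := Real.exp_nonneg _
  have hK0 : 0 ≤ 8 * (131072 * ((d : ℝ) + 1) ^ 2) := by positivity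
  refine ⟨by linarith only [h16, hct], ?_, by linarith only [hc3, hct]⟩
  have hmono : 1 + 8 * (131072 * ((d : ℝ) + 1) ^ 2) * ((L : ℝ) * cstar)
      ≤ 1 + 8 * (131072 * ((d : ℝ) + 1) ^ 2) * ((L : ℝ) * (2 * (L * cstar) + 8 * α₄)) := by
    nlinarith only [hct, hK0]
  exact (mul_le_mul_of_nonneg_left hmono hexp0).trans hsmall

end Summit.QuantumFields.YangMills.Theorems.HalvingHSupURhoWindowsGamma

end
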